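import Summits.CriticalPhenomena.PercolationContinuityZ3.Theorems.PercNearOneGluingNoHeavyLowerTailSahiCombUnique
import Summits.CriticalPhenomena.PercolationContinuityZ3.Theorems.PercNearOneGluingNoHeavyLowerTailSahiCombShapeTwo
import Summits.CriticalPhenomena.PercolationContinuityZ3.Theorems.SahiMasterFamilyLowerTransfer

/-!
# The comb (tensor-Bernstein) hierarchy for Sahi's `E_k`, IX: SYMMETRIES of the `k`-copy comb array — slot permutations and the
# up/down reflection — and the typed shape laws for DECREASING events (the percolation frame)

Support file of the one-cut programme (crux `NoHeavyLowerTail`, stmt-CriticalPhenomena-4575; cell `prim-masterthm`, seat P5).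
The percolation rows of the programme (E3GRP: `E_3` of three group SEPARATIONS) are tuples of DECREASING events; the shape laws of
`…SahiCombShape` are stated for increasing tuples (the census of P5 report §7 was run in that "up-set frame").  This file records the
two symmetries of the explicit coefficients `SahiComb.combCoeff` that make the frames interchangeable:

* **`SahiComb.combCoeff_comp_perm`** — the comb array does not depend on the ORDER of the slots (`E_n` is symmetric,
  `sahiE_comp_perm`, + uniqueness of tensor-Bernstein coefficients), although the `k`-copy kernel is not slot-symmetric;
* **`SahiComb.combCoeff_compl`** — complementing every configuration REVERSES the array: for the reflected family
  `f^c_i(ω) = f_i(ωᶜ)`, `combCoeff(f^c; j) = combCoeff(f; n − j)` on the box (fibre bijection `ω ↦ (ω_c)ᶜ_c`, kernel locality);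
  for events, `1_{compl ⁻¹' D}(ω) = 1_D(ωᶜ)` turns a decreasing tuple into an increasing one (`combLine_lower_eq`);
* consequences: each typed law for increasing tuples gives the same law for decreasing tuples, lines reversed —
  `combCoeff_ind_lower_nonneg_of_masterFamilyCombCoeffNonneg` ((M⁺-k) explicit, decreasing events), `combEndMin_lower`,
  `combEndPos_lower`, `combUnimodal_lower`, `combOrderOne_lower`; and `masterFamilyNonnegLower_of_combEndMin`: ENDMIN(k) ⟹ Sahi's
  `C_k` for DECREASING events on product measures (`MasterFamilyNonnegLower k`, the separations form).
Everything here is proved; axioms standard. [this work]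
-/

noncomputable section

open scoped Classical

namespace Summit.CriticalPhenomena.PercolationContinuityZ3.Theorems

open Finset Function
open Literature.Combinatorics.Sahi2008
open Literature.Probability.LatticeModels (isUpperSet_preimage_compl isLowerSet_preimage_compl)
open Literature.Probability.Percolation.DecisionTree (ind ind_of_mem ind_of_not_mem ind_nonneg)
open SahiComb

namespace SahiComb

variable {ι : Type*} [Fintype ι] {n : ℕ}

/-! ### Slot symmetry -/

/-- **The comb array is symmetric in the slots**: permuting the functions does not change any comb coefficient. [this work] -/
theorem combCoeff_comp_perm (σ : Equiv.Perm (Fin n)) (f : Fin n → Set ι → ℝ) (j : ι → ℕ) :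
    combCoeff n (fun i => f (σ i)) j = combCoeff n f j := by
  by_cases hj : j ∈ box (fun _ : ι => n)
  · refine bern_coeff_unique (fun p => ?_) j hj
    rw [← sahiE_bernoulliWeight_eq_sum_combCoeff, ← sahiE_bernoulliWeight_eq_sum_combCoeff, sahiE_comp_perm]
  · rw [combCoeff_eq_zero_of_not_mem_box _ hj, combCoeff_eq_zero_of_not_mem_box _ hj]

/-! ### The up/down reflection -/

/-- Complement every copy. [this work] -/
def complAll (ω : Fin n → Set ι) : Fin n → Set ι := fun c => (ω c)ᶜ

omit [Fintype ι] in
/-- Complementing twice is the identity. [folklore] -/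
theorem complAll_complAll (ω : Fin n → Set ι) : complAll (complAll ω) = ω := by
  funext c; simp [complAll]

omit [Fintype ι] in
/-- Complementing every copy reverses the profile: `j ↦ n − j`. [this work] -/
theorem profile_complAll (ω : Fin n → Set ι) : profile (complAll ω) = (fun _ => n) - profile ω := by
  funext e
  simp only [Pi.sub_apply, profile, complAll]
  have h := card_filter_add_card_filter_not (s := (univ : Finset (Fin n))) (fun c => e ∈ ω c)
  rw [card_univ, Fintype.card_fin] at h
  have h2 : (univ.filter fun c => e ∈ (ω c)ᶜ).card = (univ.filter fun c => ¬ (e ∈ ω c)).card := by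
    congr 1
  omega

/-- Reversing a profile of the box twice is the identity. [folklore] -/
theorem box_sub_sub {j : ι → ℕ} (hj : j ∈ box (fun _ : ι => n)) : (fun _ : ι => n) - ((fun _ : ι => n) - j) = j := by
  funext e; have := mem_box.1 hj e; simp only [Pi.sub_apply]; omega

/-- **Reflection reverses the comb array**: for the reflected family `f^c_i(ω) = f_i(ωᶜ)` and a profile `j ≤ n`,
`combCoeff(f^c; j) = combCoeff(f; n − j)`. [this work] -/
theorem combCoeff_compl (f : Fin n → Set ι → ℝ) {j : ι → ℕ} (hj : j ∈ box (fun _ : ι => n)) :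
    combCoeff n (fun i ω => f i ωᶜ) j = combCoeff n f ((fun _ => n) - j) := by
  unfold combCoeff
  refine sum_nbij' complAll complAll ?_ ?_ (fun ω _ => complAll_complAll ω) (fun ω _ => complAll_complAll ω) ?_
  · intro ω hω
    refine mem_filter.2 ⟨mem_univ _, ?_⟩
    rw [profile_complAll, (mem_filter.1 hω).2]
  · intro ω hω
    refine mem_filter.2 ⟨mem_univ _, ?_⟩
    rw [profile_complAll, (mem_filter.1 hω).2, box_sub_sub hj]
  · intro ω _
    exact copyKernel_congr₂ n fun i c => rfl

omit [Fintype ι] in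
/-- The indicator of the reflected event is the reflected indicator: `1_{compl ⁻¹' D}(ω) = 1_D(ωᶜ)`. [folklore] -/
theorem ind_preimage_compl (D : Set (Set ι)) (ω : Set ι) : ind (compl ⁻¹' D) ω = ind D ωᶜ := by
  by_cases h : ωᶜ ∈ D
  · rw [ind_of_mem h, ind_of_mem (Set.mem_preimage.2 h)]
  · rw [ind_of_not_mem h, ind_of_not_mem fun h' => h (Set.mem_preimage.1 h')]

/-- **Comb coefficients of a tuple of events = reversed comb coefficients of the reflected tuple.** [this work] -/
theorem combCoeff_ind_eq_compl (D : Fin n → Set (Set ι)) {j : ι → ℕ} (hj : j ∈ box (fun _ : ι => n)) :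
    combCoeff n (fun i => ind (D i)) j = combCoeff n (fun i => ind (compl ⁻¹' D i)) ((fun _ => n) - j) := by
  have h := combCoeff_compl (fun i => ind (compl ⁻¹' D i)) hj
  simp only [ind_preimage_compl, compl_compl] at h
  exact h

omit [Fintype ι] in
/-- Reversing an updated profile. [folklore] -/
theorem box_sub_update {j : ι → ℕ} (e : ι) (t : ℕ) :
    (fun _ : ι => n) - update j e t = update ((fun _ : ι => n) - j) e (n - t) := by
  funext e'
  by_cases he : e' = e
  · subst he; simp
  · simp [update_of_ne he]

/-- **Lines of a tuple = reversed lines of the reflected tuple**: `c_t(D; j) = c_{n−t}(compl ⁻¹' D; n − j)` for `t ≤ n` and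
`j ≤ n`. [this work] -/
theorem combLine_eq_compl (D : Fin n → Set (Set ι)) (e : ι) {j : ι → ℕ} (hj : j ∈ box (fun _ : ι => n)) {t : ℕ}
    (ht : t ≤ n) : combLine n D e j t = combLine n (fun i => compl ⁻¹' D i) e ((fun _ => n) - j) (n - t) := by
  unfold combLine
  have hjt : update j e t ∈ box (fun _ : ι => n) := by
    rw [mem_box]; intro e'
    by_cases he : e' = e
    · subst he; simpa using ht
    · rw [update_of_ne he]; exact mem_box.1 hj e'
  rw [combCoeff_ind_eq_compl D hjt, box_sub_update]

/-- Off the box every line of every tuple vanishes at every `t`. [this work] -/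
theorem combLine_eq_zero_of_not_mem_box (U : Fin n → Set (Set ι)) (e : ι) {j : ι → ℕ}
    (hj : update j e 0 ∉ box (fun _ : ι => n)) (t : ℕ) : combLine n U e j t = 0 := by
  unfold combLine
  refine combCoeff_eq_zero_of_not_mem_box _ fun hjt => hj (mem_box.2 fun e' => ?_)
  by_cases he : e' = e
  · subst he; simp
  · rw [update_of_ne he]; have := mem_box.1 hjt e'; rwa [update_of_ne he] at this

end SahiComb

/-! ### The typed laws for decreasing tuples -/

section Lower

open SahiComb

/-- **(M⁺-k) explicit, decreasing events**: under `MasterFamilyCombCoeffNonneg k`, every `k`-copy comb coefficient of every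
`k`-tuple of DECREASING events is `≥ 0`. [this work] -/
theorem combCoeff_ind_lower_nonneg_of_masterFamilyCombCoeffNonneg {k : ℕ} (h : MasterFamilyCombCoeffNonneg k) {ι : Type}
    [Fintype ι] (D : Fin k → Set (Set ι)) (hD : ∀ i, IsLowerSet (D i)) (j : ι → ℕ) :
    0 ≤ combCoeff k (fun i => ind (D i)) j := by
  by_cases hj : j ∈ box (fun _ : ι => k)
  · rw [combCoeff_ind_eq_compl D hj]
    exact h ι _ (fun i => isUpperSet_preimage_compl (hD i)) _
  · exact (combCoeff_eq_zero_of_not_mem_box _ hj).ge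

/-- A reflected line in normal position: for `j` with `j[e ↦ 0]` in the box and `t ≤ k`, the line of the decreasing tuple `D` at `t`
is the line of the increasing tuple `compl ⁻¹' D` through `k − j[e ↦ 0]` at `k − t`. [this work] -/
theorem SahiComb.combLine_lower_eq {k : ℕ} {ι : Type*} [Fintype ι] (D : Fin k → Set (Set ι)) (e : ι) (j : ι → ℕ)
    (hj : update j e 0 ∈ box (fun _ : ι => k)) {t : ℕ} (ht : t ≤ k) :
    combLine k D e j t = combLine k (fun i => compl ⁻¹' D i) e ((fun _ => k) - update j e 0) (k - t) := by
  have h := combLine_eq_compl D e hj ht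
  simp only [combLine, update_idem] at h ⊢
  exact h

/-- **ENDMIN for decreasing tuples** from `CombEndMin k` (the line is reversed, the law is reversal-invariant). [this work] -/
theorem combEndMin_lower {k : ℕ} (h : CombEndMin k) {ι : Type} [Fintype ι] (D : Fin k → Set (Set ι))
    (hD : ∀ i, IsLowerSet (D i)) (e : ι) (j : ι → ℕ) (t : ℕ) (ht : t ≤ k) :
    min (combLine k D e j 0) (combLine k D e j k) ≤ combLine k D e j t := by
  by_cases hj : update j e 0 ∈ box (fun _ : ι => k)
  · rw [combLine_lower_eq D e j hj (Nat.zero_le k), combLine_lower_eq D e j hj le_rfl, combLine_lower_eq D e j hj ht,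
      Nat.sub_zero, Nat.sub_self, min_comm]
    exact h ι _ (fun i => isUpperSet_preimage_compl (hD i)) e _ (k - t) (Nat.sub_le k t)
  · simp only [combLine_eq_zero_of_not_mem_box D e hj, min_self, le_refl]

/-- **ENDPOS for decreasing tuples** from `CombEndPos k`. [this work] -/
theorem combEndPos_lower {k : ℕ} (h : CombEndPos k) {ι : Type} [Fintype ι] (D : Fin k → Set (Set ι))
    (hD : ∀ i, IsLowerSet (D i)) (e : ι) (j : ι → ℕ) (t : ℕ) (ht : t ≤ k) (h0 : 0 ≤ combLine k D e j 0)
    (hk : 0 ≤ combLine k D e j k) : 0 ≤ combLine k D e j t := by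
  by_cases hj : update j e 0 ∈ box (fun _ : ι => k)
  · rw [combLine_lower_eq D e j hj (Nat.zero_le k), Nat.sub_zero] at h0
    rw [combLine_lower_eq D e j hj le_rfl, Nat.sub_self] at hk
    rw [combLine_lower_eq D e j hj ht]
    exact h ι _ (fun i => isUpperSet_preimage_compl (hD i)) e _ (k - t) (Nat.sub_le k t) hk h0
  · exact (combLine_eq_zero_of_not_mem_box D e hj t).ge

/-- **ORDER-1 for decreasing tuples** from `CombOrderOne k` (`k ≥ 2`). [this work] -/
theorem combOrderOne_lower {k : ℕ} (h : CombOrderOne k) (hk : 2 ≤ k) {ι : Type} [Fintype ι] (D : Fin k → Set (Set ι))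
    (hD : ∀ i, IsLowerSet (D i)) (e : ι) (j : ι → ℕ) :
    combLine k D e j 0 ≤ combLine k D e j 1 ∧ combLine k D e j k ≤ combLine k D e j (k - 1) := by
  by_cases hj : update j e 0 ∈ box (fun _ : ι => k)
  · obtain ⟨h01, hk1⟩ := h hk ι _ (fun i => isUpperSet_preimage_compl (hD i)) e ((fun _ => k) - update j e 0)
    rw [combLine_lower_eq D e j hj (Nat.zero_le k), combLine_lower_eq D e j hj (by omega : 1 ≤ k),
      combLine_lower_eq D e j hj le_rfl, combLine_lower_eq D e j hj (Nat.sub_le k 1), Nat.sub_zero, Nat.sub_self,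
      Nat.sub_sub_self (by omega : 1 ≤ k)]
    exact ⟨hk1, h01⟩
  · simp only [combLine_eq_zero_of_not_mem_box D e hj, le_refl, and_self]

/-- **UNI for decreasing tuples** from `CombUnimodal k` (mode reflected to `k − m`). [this work] -/
theorem combUnimodal_lower {k : ℕ} (h : CombUnimodal k) {ι : Type} [Fintype ι] (D : Fin k → Set (Set ι))
    (hD : ∀ i, IsLowerSet (D i)) (e : ι) (j : ι → ℕ) :
    ∃ m, m ≤ k ∧ MonotoneOn (combLine k D e j) (Set.Icc 0 m) ∧ AntitoneOn (combLine k D e j) (Set.Icc m k) := by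
  by_cases hj : update j e 0 ∈ box (fun _ : ι => k)
  · obtain ⟨m, hm, hmono, hanti⟩ := h ι _ (fun i => isUpperSet_preimage_compl (hD i)) e ((fun _ => k) - update j e 0)
    refine ⟨k - m, Nat.sub_le k m, ?_, ?_⟩
    · intro a ha b hb hab
      rw [combLine_lower_eq D e j hj (ha.2.trans (Nat.sub_le k m)), combLine_lower_eq D e j hj (hb.2.trans (Nat.sub_le k m))]
      exact hanti ⟨by have := hb.2; omega, Nat.sub_le k b⟩ ⟨by have := ha.2; omega, Nat.sub_le k a⟩ (by omega)
    · intro a ha b hb hab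
      rw [combLine_lower_eq D e j hj ha.2, combLine_lower_eq D e j hj hb.2]
      exact hmono ⟨Nat.zero_le _, by have := hb.1; omega⟩ ⟨Nat.zero_le _, by have := ha.1; omega⟩ (by omega)
  · refine ⟨0, Nat.zero_le k, ?_, ?_⟩ <;> intro a _ b _ _ <;>
      simp only [combLine_eq_zero_of_not_mem_box D e hj, le_refl]

/-- **ENDMIN(k) ⟹ Sahi's `C_k` for DECREASING events on product measures** (the separations form `MasterFamilyNonnegLower k`).
[this work] -/
theorem masterFamilyNonnegLower_of_combEndMin {k : ℕ} (h : CombEndMin k) : MasterFamilyNonnegLower k :=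
  (masterFamilyNonnegLower_iff k).2 (masterFamilyNonneg_of_combEndMin h)

end Lower

end Summit.CriticalPhenomena.PercolationContinuityZ3.Theorems
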